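import Summits.QuantumAdvantage.AdviceFreeQNC0.SymmetricUniqueness
import HarnessLib

/-!
# Cell qa-qnc0 (rung F-Q1, density axis): OUTSIDE-HEAVINESS of `C_8` and `C_7` at the optimum (planner qa-qnc0-p1 gen 14,
# ROUND-13 §1 / Sketch14 §OutHeavy, ask L31) — kernel, by the orbit-counting engine

`outCount K0 Y = #{u : Y u ∧ K0 u}` (points of the codeword `Y` OUTSIDE the zero set `Z(K0)`).  Sketch14's finite facts:
at each symmetric optimum of `C_8` every non-zero codeword other than the minimum word has `≥ 45 = |Z|` outside points
(`OutHeavyEight`), and at the optimum of `C_7` every non-zero codeword has `≥ 16 = |Z|` (indeed `≥ 21`) outside points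
(`OutHeavySeven`).  Here, stated with the raw count `#{u : Y u = true ∧ K0 u = true}` (definitionally Sketch14's
`outCount K0 Y`, whose name qn-prover g8 is landing with §ColumnTest; the verbatim rungs are then one-liners):

* `cEight := cwOf (univ, 1) (∅, 0)` — the exceptional word of `C_8` (`T₀ = T₂ = ¬parity`, `T₁ = 0`; weight 58, 29 points
  outside either optimum); `isMinWord_cEight`; `cEight_eq_diffEight` (it IS `K0 ⊕ K0′`);
* **`outHeavy_eight`** / **`outHeavy_eightB`**: for `K0 = symWord 8 true` resp. `symWordB 8` (the two optima, `opt_eight`),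
  every non-zero codeword `Y ≠ cEight` has `45 ≤ #{u : Y u ∧ K0 u}`;
* **`opt_seven`**: the optimum of `C_7` is `symWordB 7 = (par, ¬par, 1)` (unique, `failCount = 16`), and
  **`outHeavy_seven`**: every non-zero codeword of `C_7` has `16 ≤ #{u : Y u ∧ symWordB 7 u}`.

All by `decide +kernel` on Boolean `p`-slices of the parameter space (`heavySliceB`, exceptions `exc8c` / none).
WHAT THIS IS NOT: Sketch14's `OutHeavyButOne`/`OutHeavyEight`/`OutHeavySeven`/`StarOfOutHeavyButOne` are not declared here
(vocabulary pending in qn-prover g8's §ColumnTest file); MI / MULT₁ OPEN; separation NOT moved.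
-/

namespace Summit.QuantumAdvantage.AdviceFreeQNC0

open Finset

namespace SymCount

open Summit.QuantumAdvantage.AdviceFreeQNC0.MassInequality

variable {m : ℕ}

/-! ### Overlap of a codeword with a symmetric pattern, as a binomial sum -/

/-- Overlap count `#{u : cwOf u = true ∧ K0 u = true}` for any pattern `K0` that factors through the block weights. -/
theorem card_overlap_val (ℓ0 ℓ1 : Finset (Fin m) × Bool) (K0 : (Fin m → Bool) → Bool) (val : ℕ × ℕ × ℕ × ℕ → Bool)
    (hK0 : ∀ u, K0 u = val (bw4 ℓ0.1 ℓ1.1 u)) :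
    (univ.filter fun u : Fin m → Bool => cwOf ℓ0 ℓ1 u = true ∧ K0 u = true).card =
      G4 (bs ℓ0.1 ℓ1.1 (true, true)) (bs ℓ0.1 ℓ1.1 (true, false)) (bs ℓ0.1 ℓ1.1 (false, true))
        (bs ℓ0.1 ℓ1.1 (false, false)) (fun k => cwVal ℓ0.2 ℓ1.2 k && val k) := by
  rw [← card_filter_cwOf ℓ0 ℓ1 (fun v k => v && val k)]
  congr 1
  ext u
  simp only [mem_filter, mem_univ, true_and, hK0 u, Bool.and_eq_true]

/-- `symWordB m u` as a function of `wt u`: `(par, ¬par, 1)` selected by the class. -/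
theorem symWordB_apply (u : Fin m → Bool) : symWordB m u = sel (wt u % 3) (par (wt u)) (!par (wt u)) := by
  unfold symWordB cwOf tripleOf
  rw [affEval_eq_par, affEval_eq_par]
  simp only [Bool.false_xor, Bool.true_xor]
  rfl

/-- Value of `symWordB m` at block weights `k`. -/
def symValB (k : ℕ × ℕ × ℕ × ℕ) : Bool :=
  sel ((k.1 + k.2.1 + k.2.2.1 + k.2.2.2) % 3) (par (k.1 + k.2.1 + k.2.2.1 + k.2.2.2))
    (!par (k.1 + k.2.1 + k.2.2.1 + k.2.2.2))

/-- `symWordB m` through the block weights (any coordinate sets). -/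
theorem symWordB_eq_symValB (S0 S1 : Finset (Fin m)) (u : Fin m → Bool) : symWordB m u = symValB (bw4 S0 S1 u) := by
  rw [symWordB_apply, wt_eq_bw_sum S0 S1 u]
  rfl

/-! ### Outside-heaviness from Boolean slices -/

/-- "weight `0`, or outside count `≥ w`, or a listed exception". -/
def okHeavy (w pw cnt : ℕ) (exc : Bool) : Bool := Nat.beq pw 0 || Nat.ble w cnt || exc

/-- One `p`-slice of the outside-heaviness check for the pattern value `val`. -/
def heavySliceB (m w : ℕ) (val : ℕ × ℕ × ℕ × ℕ → Bool) (exc : ℕ → ℕ → ℕ → ℕ → Bool → Bool → Bool) (p : ℕ) : Bool :=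
  allTo (m + 1 - p) fun q => allTo (m + 1 - p - q) fun r =>
    okHeavy w (G4r p q r (m - p - q - r) fun k => cwVal false false k)
      (G4r p q r (m - p - q - r) fun k => cwVal false false k && val k) (exc p q r (m - p - q - r) false false) &&
    okHeavy w (G4r p q r (m - p - q - r) fun k => cwVal false true k)
      (G4r p q r (m - p - q - r) fun k => cwVal false true k && val k) (exc p q r (m - p - q - r) false true) &&
    okHeavy w (G4r p q r (m - p - q - r) fun k => cwVal true false k)
      (G4r p q r (m - p - q - r) fun k => cwVal true false k && val k) (exc p q r (m - p - q - r) true false) &&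
    okHeavy w (G4r p q r (m - p - q - r) fun k => cwVal true true k)
      (G4r p q r (m - p - q - r) fun k => cwVal true true k && val k) (exc p q r (m - p - q - r) true true)

/-- `okHeavy` with non-zero weight: the bound or the exception. -/
theorem okHeavy_spec {w pw cnt : ℕ} {exc : Bool} (h : okHeavy w pw cnt exc = true) (hpw : pw ≠ 0) :
    w ≤ cnt ∨ exc = true := by
  unfold okHeavy at h
  rw [Bool.or_eq_true, Bool.or_eq_true, Nat.beq_eq, Nat.ble_eq] at h
  rcases h with (h | h) | h
  · exact absurd h hpw
  · exact Or.inl h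
  · exact Or.inr h

/-- **Outside-heaviness from the slices**: a non-zero codeword has `≥ w` points where `K0 = true`, or lies in an
exceptional parameter class. -/
theorem heavy_or_exc {m w : ℕ} {val : ℕ × ℕ × ℕ × ℕ → Bool} {exc : ℕ → ℕ → ℕ → ℕ → Bool → Bool → Bool}
    (h : ∀ p ≤ m, heavySliceB m w val exc p = true) {K0 : (Fin m → Bool) → Bool}
    (hK0 : ∀ S0 S1 : Finset (Fin m), ∀ u, K0 u = val (bw4 S0 S1 u))
    {Y : (Fin m → Bool) → Bool} (hY : IsElim1 m Y) (hY0 : pwt Y ≠ 0) :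
    w ≤ (univ.filter fun u : Fin m → Bool => Y u = true ∧ K0 u = true).card ∨
      ∃ S0 S1 : Finset (Fin m), ∃ a0 a1 : Bool, Y = cwOf (S0, a0) (S1, a1) ∧
        exc (bs S0 S1 (true, true)) (bs S0 S1 (true, false)) (bs S0 S1 (false, true)) (bs S0 S1 (false, false)) a0 a1
          = true := by
  obtain ⟨⟨S0, a0⟩, ⟨S1, a1⟩, rfl⟩ := exists_cwOf hY
  rw [card_overlap_val (S0, a0) (S1, a1) K0 val (hK0 S0 S1), ← G4q_eq, ← G4r_eq]
  rw [pwt_cwOf, ← G4q_eq, ← G4r_eq] at hY0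
  have hs := bs_sum S0 S1
  have h1 := allTo_spec (h (bs S0 S1 (true, true)) (by omega)) (bs S0 S1 (true, false)) (by omega)
  have h2 := allTo_spec h1 (bs S0 S1 (false, true)) (by omega)
  simp only [Bool.and_eq_true] at h2
  rw [show m - bs S0 S1 (true, true) - bs S0 S1 (true, false) - bs S0 S1 (false, true) =
    bs S0 S1 (false, false) by omega] at h2
  obtain ⟨⟨⟨hff, hft⟩, htf⟩, htt⟩ := h2
  have key : w ≤ G4r (bs S0 S1 (true, true)) (bs S0 S1 (true, false)) (bs S0 S1 (false, true))
      (bs S0 S1 (false, false)) (fun k => cwVal a0 a1 k && val k) ∨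
      exc (bs S0 S1 (true, true)) (bs S0 S1 (true, false)) (bs S0 S1 (false, true)) (bs S0 S1 (false, false)) a0 a1
        = true := by
    cases a0 <;> cases a1
    · exact okHeavy_spec hff hY0
    · exact okHeavy_spec hft hY0
    · exact okHeavy_spec htf hY0
    · exact okHeavy_spec htt hY0
  rcases key with hk | hk
  · exact Or.inl hk
  · exact Or.inr ⟨S0, S1, a0, a1, rfl, hk⟩

/-! ### m = 8: the exceptional word and the two optima -/

/-- The exceptional word of `C_8`: `(T₀, T₁, T₂) = (¬parity, 0, ¬parity)` (`= K0 ⊕ K0′`, weight 58). -/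
def cEight : (Fin 8 → Bool) → Bool := cwOf ((univ : Finset (Fin 8)), true) ((∅ : Finset (Fin 8)), false)

/-- `cEight` is the difference of the two optima. -/
theorem cEight_eq_diffEight : cEight = diffEight := by
  funext u
  revert u
  unfold cEight diffEight symWord symWordB cwOf tripleOf sel affEval wt
  decide +kernel

/-- `cEight` is a minimum-weight word of `C_8`. -/
theorem isMinWord_cEight : IsMinWord 8 cEight := by
  rw [cEight_eq_diffEight]; exact isMinWord_diffEight

/-- The exceptional class at `m = 8`: `(S0, S1, α0, α1) = (univ, ∅, 1, 0)`. -/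
def exc8c (p q r s : ℕ) (a0 a1 : Bool) : Bool :=
  Nat.beq p 0 && Nat.beq q 8 && Nat.beq r 0 && Nat.beq s 0 && a0 && !a1

/-- A codeword in the exceptional class IS `cEight`. -/
theorem eq_cEight_of_exc {S0 S1 : Finset (Fin 8)} {a0 a1 : Bool}
    (h : exc8c (bs S0 S1 (true, true)) (bs S0 S1 (true, false)) (bs S0 S1 (false, true)) (bs S0 S1 (false, false))
      a0 a1 = true) : cwOf (S0, a0) (S1, a1) = cEight := by
  unfold exc8c at h
  simp only [Bool.and_eq_true, Nat.beq_eq, Bool.not_eq_true'] at h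
  obtain ⟨⟨⟨⟨⟨_, hq⟩, _⟩, _⟩, ha0⟩, ha1⟩ := h
  obtain ⟨h0, h1⟩ := sets_of_bs_full (e0 := true) (e1 := false) hq
  subst ha0; subst ha1; rw [h0, h1]; rfl

/-- Slices for `K0 = symWord 8 true`. -/
theorem heavySlice8A_0 : heavySliceB 8 45 (fun k => symVal true k) exc8c 0 = true := by decide +kernel
/-- Slice `p = 1` (`K0 = symWord 8 true`). -/
theorem heavySlice8A_1 : heavySliceB 8 45 (fun k => symVal true k) exc8c 1 = true := by decide +kernel
/-- Slice `p = 2` (`K0 = symWord 8 true`). -/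
theorem heavySlice8A_2 : heavySliceB 8 45 (fun k => symVal true k) exc8c 2 = true := by decide +kernel
/-- Slice `p = 3` (`K0 = symWord 8 true`). -/
theorem heavySlice8A_3 : heavySliceB 8 45 (fun k => symVal true k) exc8c 3 = true := by decide +kernel
/-- Slice `p = 4` (`K0 = symWord 8 true`). -/
theorem heavySlice8A_4 : heavySliceB 8 45 (fun k => symVal true k) exc8c 4 = true := by decide +kernel
/-- Slice `p = 5` (`K0 = symWord 8 true`). -/
theorem heavySlice8A_5 : heavySliceB 8 45 (fun k => symVal true k) exc8c 5 = true := by decide +kernel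
/-- Slice `p = 6` (`K0 = symWord 8 true`). -/
theorem heavySlice8A_6 : heavySliceB 8 45 (fun k => symVal true k) exc8c 6 = true := by decide +kernel
/-- Slice `p = 7` (`K0 = symWord 8 true`). -/
theorem heavySlice8A_7 : heavySliceB 8 45 (fun k => symVal true k) exc8c 7 = true := by decide +kernel
/-- Slice `p = 8` (`K0 = symWord 8 true`). -/
theorem heavySlice8A_8 : heavySliceB 8 45 (fun k => symVal true k) exc8c 8 = true := by decide +kernel

/-- All slices (`K0 = symWord 8 true`). -/
theorem heavySlices8A : ∀ p ≤ 8, heavySliceB 8 45 (fun k => symVal true k) exc8c p = true := by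
  intro p hp
  interval_cases p
  · exact heavySlice8A_0
  · exact heavySlice8A_1
  · exact heavySlice8A_2
  · exact heavySlice8A_3
  · exact heavySlice8A_4
  · exact heavySlice8A_5
  · exact heavySlice8A_6
  · exact heavySlice8A_7
  · exact heavySlice8A_8

/-- Slices for `K0 = symWordB 8`. -/
theorem heavySlice8B_0 : heavySliceB 8 45 (symValB) exc8c 0 = true := by decide +kernel
/-- Slice `p = 1` (`K0 = symWordB 8`). -/
theorem heavySlice8B_1 : heavySliceB 8 45 (symValB) exc8c 1 = true := by decide +kernel
/-- Slice `p = 2` (`K0 = symWordB 8`). -/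
theorem heavySlice8B_2 : heavySliceB 8 45 (symValB) exc8c 2 = true := by decide +kernel
/-- Slice `p = 3` (`K0 = symWordB 8`). -/
theorem heavySlice8B_3 : heavySliceB 8 45 (symValB) exc8c 3 = true := by decide +kernel
/-- Slice `p = 4` (`K0 = symWordB 8`). -/
theorem heavySlice8B_4 : heavySliceB 8 45 (symValB) exc8c 4 = true := by decide +kernel
/-- Slice `p = 5` (`K0 = symWordB 8`). -/
theorem heavySlice8B_5 : heavySliceB 8 45 (symValB) exc8c 5 = true := by decide +kernel
/-- Slice `p = 6` (`K0 = symWordB 8`). -/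
theorem heavySlice8B_6 : heavySliceB 8 45 (symValB) exc8c 6 = true := by decide +kernel
/-- Slice `p = 7` (`K0 = symWordB 8`). -/
theorem heavySlice8B_7 : heavySliceB 8 45 (symValB) exc8c 7 = true := by decide +kernel
/-- Slice `p = 8` (`K0 = symWordB 8`). -/
theorem heavySlice8B_8 : heavySliceB 8 45 (symValB) exc8c 8 = true := by decide +kernel

/-- All slices (`K0 = symWordB 8`). -/
theorem heavySlices8B : ∀ p ≤ 8, heavySliceB 8 45 (symValB) exc8c p = true := by
  intro p hp
  interval_cases p
  · exact heavySlice8B_0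
  · exact heavySlice8B_1
  · exact heavySlice8B_2
  · exact heavySlice8B_3
  · exact heavySlice8B_4
  · exact heavySlice8B_5
  · exact heavySlice8B_6
  · exact heavySlice8B_7
  · exact heavySlice8B_8

/-- **Outside-heaviness at `K0 = symWord 8 true`** (L31): every non-zero codeword other than `cEight` has at least
`45 = |Z(K0)|` points outside `Z(K0)`. -/
theorem outHeavy_eight : ∀ Y, IsElim1 8 Y → pwt Y ≠ 0 → Y ≠ cEight →
    45 ≤ (univ.filter fun u : Fin 8 → Bool => Y u = true ∧ symWord 8 true u = true).card := by
  intro Y hY hY0 hne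
  rcases heavy_or_exc heavySlices8A (fun S0 S1 u => symWord_eq_symVal true S0 S1 u) hY hY0 with h | h
  · exact h
  · obtain ⟨S0, S1, a0, a1, rfl, hexc⟩ := h
    exact absurd (eq_cEight_of_exc hexc) hne

/-- **Outside-heaviness at `K0 = symWordB 8`** (L31): the same at the second optimum. -/
theorem outHeavy_eightB : ∀ Y, IsElim1 8 Y → pwt Y ≠ 0 → Y ≠ cEight →
    45 ≤ (univ.filter fun u : Fin 8 → Bool => Y u = true ∧ symWordB 8 u = true).card := by
  intro Y hY hY0 hne
  rcases heavy_or_exc heavySlices8B (fun S0 S1 u => symWordB_eq_symValB S0 S1 u) hY hY0 with h | h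
  · exact h
  · obtain ⟨S0, S1, a0, a1, rfl, hexc⟩ := h
    exact absurd (eq_cEight_of_exc hexc) hne

/-! ### m = 7: the unique optimum `symWordB 7` and outside-heaviness without exception -/

/-- Exception at `m = 7`: `(univ, univ, 0, 1)`. -/
def exc7 (p q r s : ℕ) (a0 a1 : Bool) : Bool :=
  Nat.beq p 7 && Nat.beq q 0 && Nat.beq r 0 && Nat.beq s 0 && !a0 && a1

/-- No exception. -/
def excNone (_ _ _ _ : ℕ) (_ _ : Bool) : Bool := false

/-- Slice `p = 0` of the uniqueness check at `m = 7`. -/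
theorem uniqSlice7_0 : uniqSliceB 7 16 exc7 0 = true := by decide +kernel
/-- Slice `p = 1` of the uniqueness check at `m = 7`. -/
theorem uniqSlice7_1 : uniqSliceB 7 16 exc7 1 = true := by decide +kernel
/-- Slice `p = 2` of the uniqueness check at `m = 7`. -/
theorem uniqSlice7_2 : uniqSliceB 7 16 exc7 2 = true := by decide +kernel
/-- Slice `p = 3` of the uniqueness check at `m = 7`. -/
theorem uniqSlice7_3 : uniqSliceB 7 16 exc7 3 = true := by decide +kernel
/-- Slice `p = 4` of the uniqueness check at `m = 7`. -/
theorem uniqSlice7_4 : uniqSliceB 7 16 exc7 4 = true := by decide +kernel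
/-- Slice `p = 5` of the uniqueness check at `m = 7`. -/
theorem uniqSlice7_5 : uniqSliceB 7 16 exc7 5 = true := by decide +kernel
/-- Slice `p = 6` of the uniqueness check at `m = 7`. -/
theorem uniqSlice7_6 : uniqSliceB 7 16 exc7 6 = true := by decide +kernel
/-- Slice `p = 7` of the uniqueness check at `m = 7`. -/
theorem uniqSlice7_7 : uniqSliceB 7 16 exc7 7 = true := by decide +kernel

/-- All uniqueness slices at `m = 7`. -/
theorem uniqSlices7 : ∀ p ≤ 7, uniqSliceB 7 16 exc7 p = true := by
  intro p hp
  interval_cases p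
  · exact uniqSlice7_0
  · exact uniqSlice7_1
  · exact uniqSlice7_2
  · exact uniqSlice7_3
  · exact uniqSlice7_4
  · exact uniqSlice7_5
  · exact uniqSlice7_6
  · exact uniqSlice7_7

/-- `failCount (symWordB 7) = 16`. -/
theorem failCount_symWordB_seven : failCount (symWordB 7) = 16 := by
  unfold failCount symWordB cwOf tripleOf sel affEval wt
  decide +kernel

/-- **The optimal codeword of `C_7` is `symWordB 7`** (unique; `w(7,1) = 16`, cf. prover-2's `Dom7.isOpt1_K0`). -/
theorem opt_seven {K0 : (Fin 7 → Bool) → Bool} (hK : IsOpt1 7 K0) : K0 = symWordB 7 := by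
  have hle : failCount K0 ≤ 16 := by
    have := hK.2 _ (isElim1_cwOf ((univ : Finset (Fin 7)), false) ((univ : Finset (Fin 7)), true))
    rwa [show cwOf ((univ : Finset (Fin 7)), false) ((univ : Finset (Fin 7)), true) = symWordB 7 from rfl,
      failCount_symWordB_seven] at this
  obtain ⟨S0, S1, a0, a1, rfl, hexc⟩ := exc_of_uniqSlices uniqSlices7 hK.1 hle
  unfold exc7 at hexc
  simp only [Bool.and_eq_true, Nat.beq_eq, Bool.not_eq_true'] at hexc
  obtain ⟨⟨⟨⟨⟨hp, _⟩, _⟩, _⟩, ha0⟩, ha1⟩ := hexc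
  obtain ⟨h0, h1⟩ := sets_of_bs_full (e0 := true) (e1 := true) hp
  subst ha0; subst ha1; rw [h0, h1]; rfl

/-- Slice `p = 0` of the outside-heaviness check at `m = 7`. -/
theorem heavySlice7_0 : heavySliceB 7 16 symValB excNone 0 = true := by decide +kernel
/-- Slice `p = 1` of the outside-heaviness check at `m = 7`. -/
theorem heavySlice7_1 : heavySliceB 7 16 symValB excNone 1 = true := by decide +kernel
/-- Slice `p = 2` of the outside-heaviness check at `m = 7`. -/
theorem heavySlice7_2 : heavySliceB 7 16 symValB excNone 2 = true := by decide +kernel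
/-- Slice `p = 3` of the outside-heaviness check at `m = 7`. -/
theorem heavySlice7_3 : heavySliceB 7 16 symValB excNone 3 = true := by decide +kernel
/-- Slice `p = 4` of the outside-heaviness check at `m = 7`. -/
theorem heavySlice7_4 : heavySliceB 7 16 symValB excNone 4 = true := by decide +kernel
/-- Slice `p = 5` of the outside-heaviness check at `m = 7`. -/
theorem heavySlice7_5 : heavySliceB 7 16 symValB excNone 5 = true := by decide +kernel
/-- Slice `p = 6` of the outside-heaviness check at `m = 7`. -/
theorem heavySlice7_6 : heavySliceB 7 16 symValB excNone 6 = true := by decide +kernel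
/-- Slice `p = 7` of the outside-heaviness check at `m = 7`. -/
theorem heavySlice7_7 : heavySliceB 7 16 symValB excNone 7 = true := by decide +kernel

/-- All outside-heaviness slices at `m = 7`. -/
theorem heavySlices7 : ∀ p ≤ 7, heavySliceB 7 16 symValB excNone p = true := by
  intro p hp
  interval_cases p
  · exact heavySlice7_0
  · exact heavySlice7_1
  · exact heavySlice7_2
  · exact heavySlice7_3
  · exact heavySlice7_4
  · exact heavySlice7_5
  · exact heavySlice7_6
  · exact heavySlice7_7

/-- **Outside-heaviness of `C_7`** (L31, `OutHeavySeven` in raw form): at the optimum every non-zero codeword has at least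
`16 = |Z|` points outside `Z`. -/
theorem outHeavy_seven : ∀ Y, IsElim1 7 Y → pwt Y ≠ 0 →
    16 ≤ (univ.filter fun u : Fin 7 → Bool => Y u = true ∧ symWordB 7 u = true).card := by
  intro Y hY hY0
  rcases heavy_or_exc heavySlices7 (fun S0 S1 u => symWordB_eq_symValB S0 S1 u) hY hY0 with h | h
  · exact h
  · obtain ⟨_, _, _, _, _, hexc⟩ := h
    exact absurd hexc (by simp [excNone])

end SymCount

end Summit.QuantumAdvantage.AdviceFreeQNC0
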